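import Mathlib
import Summits.AtomisticToContinuum.HydrodynamicLimit.Theorems.ImplosionDichotomyDenseExcursionSonicCavityDefsB

/-!
# Vocabulary of the line `sonic-cavity-renewal`, part C (skeleton reshape v7 of crux `DenseExcursion`,
# stmt-AtomisticToContinuum-12586): the additional CERTIFIED profile data the high-frequency stubs consume

Definitions file (`--supports stmt-AtomisticToContinuum-12586`, line lead a2). Why a part C (findings of wave 2, recorded in
`Cruxes/DenseExcursion/NOTES-a2b.md`): the two halves of `|Im Λ|`-confinement (`SonicSlaving`, `CentreContent`, part B) are TRUE
for the pinned profile with margins ×2500 and ×47, but are NOT provable with usable constants from `CavityTube` (part A) alone: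

1. SONIC SIDE. Smoothness at the repulsive sonic point is information AT `x = 0`; carrying it along the real axis to the matching
   point `x_m = −7/10` costs the amplification `e^{K}` of free p-wave content (`K = ∫(−Re q)⁺ = 12.35` on `SS(r₂)`, `≥ 33` from the
   tube's constants), which no finite-order slaving can beat with `C²` profile data. The route that works at all orders at once is
   CONTOUR TRANSPORT: the smooth mode is analytic at the sonic point (landed `smoothMode_analyticAt_sonic`, p147901), continues
   analytically wherever the profile does, and off the real axis the transport kernel is suppressed by `e^{−|η|·|Im Λ|·h}`
   (`|Im Λ| > 1000`, height `|η| ≈ 0.04–0.12`: `e^{−180}` against `e^{45}`). DATA NEEDED: an analytic continuation of `(W, S)` to a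
   complex wedge around `[x_m, 0]` with explicit bounds — `CavityTubeWedge` below (wave-2 report `W2_sonicSlaving.REPORT.md` §3;
   every numeral validated on `SS(r₂)` by continuing the profile ODE off the axis, `complexwedge.py`: `min|c₋| = 1.65` vs `1`,
   `min|c₊|/|z| = 0.42` vs `3/10`, `max|Im k|/Re k = 0.087` (disc: `0.109`) vs `1/5`, `|W| ≤ 0.18` vs `1/4`, `|S| ≤ 1.74` vs `5/2`,
   `|W′| ≤ 0.25` vs `1/2`, `|S′| ≤ 1.71` vs `5/2`, `|W″| ≤ 0.94` vs `2`, `|S″| ≤ 1.75` vs `3`). Certifiable by Taylor models of the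
   BCG profile in `ℂ` (the profile is real-analytic on the whole core; sonic series radius `0.14`).
2. CENTRE SIDE. The inner standing wave is landed (`centre_inner_standing_wave`, p152423: at `x = log(1/100)` the two acoustic
   amplitudes agree within a factor `2`); the bulk transport of the amplitude ratio on `[log(1/100), −7/10]` by the landed weighted
   Levinson lemma closes with honest box-suprema (`K ≈ 38 ≤ 140`) but NOT with termwise bounds near `x_m`, where part A's centre
   expansion (d) (remainder `2e^{4x} = 0.12` at `x_m`) is too wide. DATA NEEDED: pointwise envelopes of the eight bulk quantities of the weighted-Levinson budget on
   `[log(1/100), −7/10]` — `CavityTubeBulk` below (wave-2 report `W3_centreContent.REPORT.md` §3–4 + the worker's `tubeB_budget.py`: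
   envelopes at ≥ 1.3× the true values give `K = 30.75 ≤ 140`). Certifiable by the centre series in `e^{2x}` (radius `≈ 1.2` in `R = eˣ`, i.e. all of `x ≤ 0`).
3. THE PINNED RATE. The packing-order resolvent at orders `k = 2, 3` is read off `CavityResolventCk 5` at `Λ = kμ`, which must avoid
   the `1/20`-disc around the package rate `Λ₁`; part A's window `(6(r−1), 9(r−1)) = (2μ, 3μ)` does not guarantee that, the certified
   enclosure `Λ₁ ∈ [3/4, 17/20]` does on the pinned speed window `[17307/15625, 697/625]` (`2μ ≤ 0.6912 < 0.70`, `3μ ≥ 0.9688 > 0.90`;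
   seven codes: `Λ₁ = 0.7971` at `r₂`) — `PinnedRate` below (validated Evans enclosure; certifiable with the Evans engine of the plan).

All three are finite lists of explicit inequalities about the EXPLICIT pinned profile: they enter the line only through the ∃-stub
`stub_boxPackage` (whose conclusion absorbs them) and as hypotheses of the ∀-stubs. NOT here: any proof of a stub.
-/

noncomputable section

open Filter Set
open scoped Topology ContDiff

namespace Summit.AtomisticToContinuum.HydrodynamicLimit.Theorems.SonicCavityRenewal

open Summit.AtomisticToContinuum.HydrodynamicLimit.Theorems.R2OneModeTwoConditions

/-! ## The complex wedge around `[x_m, 0]` -/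

/-- THE SONIC WEDGE: the open complex neighbourhood of the real segment `[−4/5, 1/20]` made of the wedge `|Im z| < 3/20·|Re z|`
(opening towards the core), the strip `|Im z| < 1/20`, and the disc `‖z‖ < 1/20` at the sonic point — the region on which the pinned
profile is certified holomorphic with bounds (`CavityTubeWedge`). -/
def sonicWedge : Set ℂ :=
  {z : ℂ | -(4 / 5 : ℝ) < z.re ∧ z.re < 1 / 20 ∧ |z.im| < max (3 / 20 * |z.re|) (1 / 20)} ∪ Metric.ball 0 (1 / 20)

/-- THE WEDGE CLAUSE (f) OF THE TUBE: `W` and `S` continue to holomorphic functions `Wc`, `Sc` on `sonicWedge`, agreeing with `W`, `S`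
on the real segment `(−4/5, 1/20)`, with the `C²`-size bounds `‖Wc‖ ≤ 1/4`, `‖Sc‖ ≤ 5/2`, `‖Wc′‖ ≤ 1/2`, `‖Sc′‖ ≤ 5/2`, `‖Wc″‖ ≤ 2`,
`‖Sc″‖ ≤ 3`, NO complex zero of the regular speed (`‖Wc − 1 − Sc‖ ≥ 1`), the degenerate speed vanishing only at the sonic point and
linearly (`‖Wc − 1 + Sc‖ ≥ (3/10)‖z‖`), and its slope `k(z) = (Wc − 1 + Sc)/(−z)` in the sector `|Im k| ≤ Re k / 5` (so that the
Frobenius exponent keeps its sign structure off the axis). Numerals carry ≥ 1.3× slack over `SS(r₂)` (module docstring). -/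
def CavityTubeWedge (W S : ℝ → ℝ) : Prop :=
  ∃ Wc Sc : ℂ → ℂ, DifferentiableOn ℂ Wc sonicWedge ∧ DifferentiableOn ℂ Sc sonicWedge ∧
    (∀ x : ℝ, -(4 / 5 : ℝ) < x → x < 1 / 20 → Wc x = W x ∧ Sc x = S x) ∧
    (∀ z ∈ sonicWedge, ‖Wc z‖ ≤ 1 / 4 ∧ ‖Sc z‖ ≤ 5 / 2 ∧ ‖deriv Wc z‖ ≤ 1 / 2 ∧ ‖deriv Sc z‖ ≤ 5 / 2 ∧
      ‖deriv (deriv Wc) z‖ ≤ 2 ∧ ‖deriv (deriv Sc) z‖ ≤ 3) ∧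
    (∀ z ∈ sonicWedge, 1 ≤ ‖Wc z - 1 - Sc z‖) ∧
    (∀ z ∈ sonicWedge, 3 / 10 * ‖z‖ ≤ ‖Wc z - 1 + Sc z‖) ∧
    (∀ z ∈ sonicWedge, z ≠ 0 → |((Wc z - 1 + Sc z) / (-z)).im| ≤ 1 / 5 * ((Wc z - 1 + Sc z) / (-z)).re)

/-- The wedge contains the real segment `(−4/5, 1/20)`. [folklore] -/
theorem ofReal_mem_sonicWedge {x : ℝ} (h1 : -(4 / 5 : ℝ) < x) (h2 : x < 1 / 20) : (x : ℂ) ∈ sonicWedge := by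
  left
  refine ⟨by simpa using h1, by simpa using h2, ?_⟩
  simp only [Complex.ofReal_im, abs_zero]
  exact lt_max_of_lt_right (by norm_num)

/-- The wedge contains the matching point `x_m = −7/10` and the sonic point. [folklore] -/
theorem matchPoint_mem_sonicWedge : ((matchPoint : ℝ) : ℂ) ∈ sonicWedge ∧ (0 : ℂ) ∈ sonicWedge := by
  refine ⟨ofReal_mem_sonicWedge (by norm_num [matchPoint]) (by norm_num [matchPoint]), ?_⟩
  right
  simp

/-! ## The bulk envelopes on `[log(1/100), −7/10]` -/

/-- Degenerate (outgoing) characteristic speed `c₊ = (W − 1) + S` (positive on the core `x < 0`). -/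
def bulkCp (W S : ℝ → ℝ) (x : ℝ) : ℝ := W x - 1 + S x

/-- Regular (incoming) characteristic speed `c₋ = (W − 1) − S` (negative). -/
def bulkCm (W S : ℝ → ℝ) (x : ℝ) : ℝ := W x - 1 - S x

/-- Diagonal coefficient `b₊₊ = ⅔W′ + 2W − r + 2S′ + 4S` of the characteristic mode system (`mode_char_system`). -/
def bulkBpp (r : ℝ) (W S : ℝ → ℝ) (x : ℝ) : ℝ := 2 / 3 * deriv W x + 2 * W x - r + 2 * deriv S x + 4 * S x

/-- Diagonal coefficient `b₋₋ = ⅔W′ + 2W − r − 2S′ − 4S`. -/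
def bulkBmm (r : ℝ) (W S : ℝ → ℝ) (x : ℝ) : ℝ := 2 / 3 * deriv W x + 2 * W x - r - 2 * deriv S x - 4 * S x

/-- Coupling coefficient `b₊₋ = W′/3 + S′ + 2S`. -/
def bulkBpm (W S : ℝ → ℝ) (x : ℝ) : ℝ := deriv W x / 3 + deriv S x + 2 * S x

/-- Coupling coefficient `b₋₊ = W′/3 − S′ − 2S`. -/
def bulkBmp (W S : ℝ → ℝ) (x : ℝ) : ℝ := deriv W x / 3 - deriv S x - 2 * S x

/-- The normalised coupling `G = b₋₊c₊/(2S)` of the `+`-gauge Levinson system (`β/q = −b₋₊c₊/M`, `M = c₊c₋q ≈ 2SΛ`). -/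
def bulkG (W S : ℝ → ℝ) (x : ℝ) : ℝ := bulkBmp W S x * bulkCp W S x / (2 * S x)

/-- The normalised coupling `H = b₊₋c₋/(2S)` (`α/q = −b₊₋c₋/M`). -/
def bulkH (W S : ℝ → ℝ) (x : ℝ) : ℝ := bulkBpm W S x * bulkCm W S x / (2 * S x)

/-- The `O(1)` part `R = (c₋b₊₊ − c₊b₋₋)/(2S) = −(⅔W′ + 2W − r) + (W − 1)(2S′ + 4S)/S` of `M/(2S) = Λ + R`. -/
def bulkR (r : ℝ) (W S : ℝ → ℝ) (x : ℝ) : ℝ := -(2 / 3 * deriv W x + 2 * W x - r) + (W x - 1) * (2 * deriv S x + 4 * S x) / S x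

/-- THE BULK CLAUSE (g) OF THE TUBE: pointwise envelopes, on the bulk `log(1/100) ≤ x ≤ −7/10` of the core, of the eight quantities the
weighted-Levinson transport of the acoustic amplitude ratio consumes (wave-2/3 worker budget `tubeB_budget.py`: with these envelopes,
each ≥ 1.3× the true value on `SS(r₂)` uniformly on the range, the bulk constant is `K = 30.75 ≤ 140`; all small terms may be inflated
×2.04 and the growth integral by `+0.90` before `K > 140`): the couplings `|G| ≤ e^{−x}/2`, `|G′| ≤ 0.51e^{−x}`, `|H| ≤ 0.51e^{−x} + 0.61`,
`|H′| ≤ 0.51e^{−x}`, `|b₋₊||b₊₋|/(2S) ≤ 0.53e^{−x}`, the drift `|R′| ≤ 1/5`, the growth `b₊₊/c₊ + b₋₋/|c₋| ≤ eˣ(3 + 4e^{2x} + 10e^{4x})`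
and the slowness `1/c₊ + 1/|c₋| ≤ eˣ(17/5 + 4e^{2x} + 8e^{4x})` (true ranges on `SS(r₂)`: `eˣ|G| ∈ [0.175, 0.383]`, `eˣ|G′| ≤ 0.388`,
`eˣ|H| ≤ 0.623`, `eˣ|H′| ≤ 0.388`, `eˣP₃ ≤ 0.406`, `|R′| ≤ 0.117`, `e^{−x}·growth ∈ [2.94, 4.40]`). Certifiable by the centre series in `e^{2x}`. -/
def CavityTubeBulk (r : ℝ) (W S : ℝ → ℝ) : Prop :=
  ∀ x : ℝ, Real.log (1 / 100) ≤ x → x ≤ -(7 / 10) →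
    |bulkG W S x| ≤ 1 / 2 * Real.exp (-x) ∧
    |deriv (bulkG W S) x| ≤ 51 / 100 * Real.exp (-x) ∧
    |bulkH W S x| ≤ 51 / 100 * Real.exp (-x) + 61 / 100 ∧
    |deriv (bulkH W S) x| ≤ 51 / 100 * Real.exp (-x) ∧
    |bulkBmp W S x| * |bulkBpm W S x| / (2 * S x) ≤ 53 / 100 * Real.exp (-x) ∧
    |deriv (bulkR r W S) x| ≤ 1 / 5 ∧
    bulkBpp r W S x / bulkCp W S x + bulkBmm r W S x / |bulkCm W S x| ≤
      Real.exp x * (3 + 4 * Real.exp (2 * x) + 10 * Real.exp (4 * x)) ∧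
    1 / bulkCp W S x + 1 / |bulkCm W S x| ≤ Real.exp x * (17 / 5 + 4 * Real.exp (2 * x) + 8 * Real.exp (4 * x))

/-! ## The pinned rate -/

/-- THE PINNED RATE: the package rate is certified in `[3/4, 17/20]` — a real smooth radial mode exists at some `Λ₁` there (seven
codes: `Λ₁ = 0.7971` at `r₂`; by the box package's exclusivity it IS the package's `Λ₁`). Consumed only to keep the packing orders
`2μ`, `3μ` out of the `1/20`-disc around `Λ₁` when `CavityResolventCk 5` is read at `Λ = kμ`. -/
def PinnedRate (r : ℝ) (W S : ℝ → ℝ) : Prop :=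
  ∃ Λ₁ : ℝ, 3 / 4 ≤ Λ₁ ∧ Λ₁ ≤ 17 / 20 ∧ ∃ ŵ ŝ : ℝ → ℂ, IsSmoothRadialMode r W S (Λ₁ : ℂ) ŵ ŝ

/-- On the pinned speed window the packing orders `kμ`, `μ = 3(r − 1)`, `k ≥ 1`, stay `1/20` away from any rate in `[3/4, 17/20]`:
`kμ ≤ 2μ ≤ 0.6912` for `k ≤ 2` and `kμ ≥ 3μ ≥ 0.9688` for `k ≥ 3`. Pure arithmetic (registered sub-goal `packingOrder_avoids_pinnedRate`
of stmt-AtomisticToContinuum-12586). -/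
theorem packingOrder_avoids_pinnedRate : ∀ (r Λ₁ : ℝ) (k : ℕ), (17307 / 15625 : ℝ) ≤ r → r ≤ 697 / 625 → 3 / 4 ≤ Λ₁ → Λ₁ ≤ 17 / 20 → 1 ≤ k → (1 / 20 : ℝ) ≤ |(k : ℝ) * (3 * (r - 1)) - Λ₁| := by
  intro r Λ₁ k hlo hhi h1 h2 hk
  rcases Nat.lt_or_ge k 3 with hk3 | hk3
  · -- k = 1 or k = 2: kμ ≤ 2μ ≤ 0.6912 ≤ Λ₁ − 1/20
    have hk2 : (k : ℝ) ≤ 2 := by exact_mod_cast (by omega : k ≤ 2)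
    have hμ : 0 ≤ 3 * (r - 1) := by linarith
    have hle : (k : ℝ) * (3 * (r - 1)) ≤ 2 * (3 * (r - 1)) := mul_le_mul_of_nonneg_right hk2 hμ
    rw [abs_sub_comm, abs_of_nonneg (by nlinarith)]
    nlinarith
  · -- k ≥ 3: kμ ≥ 3μ ≥ 0.9688 ≥ Λ₁ + 1/20
    have hk3' : (3 : ℝ) ≤ k := by exact_mod_cast hk3
    have hμ : 0 ≤ 3 * (r - 1) := by linarith
    have hge : 3 * (3 * (r - 1)) ≤ (k : ℝ) * (3 * (r - 1)) := mul_le_mul_of_nonneg_right hk3' hμ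
    rw [abs_of_nonneg (by nlinarith)]
    nlinarith

end Summit.AtomisticToContinuum.HydrodynamicLimit.Theorems.SonicCavityRenewal

end
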